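import Mathlib
import HarnessLib
import Summits.Ventures.LatticeQCDFlow.Exactness.NCMCGeneralSpaceReplicaTStatisticCoverageChains
import Summits.Ventures.LatticeQCDFlow.Exactness.NCMCGeneralSpaceReplicaTStatisticQuantile

/-!
# For every level there is ONE quantile making the replica-`t` interval of `R ≥ 2` independent chains asymptotically exact — for every chain, observable and family of starts

HONEST FRAMING: exact (Metropolis-corrected) sampling algorithms for lattice gauge theory;
figures of merit are autocorrelation/cost numbers at stated couplings and volumes; no
continuum-physics claim.

Venture `LatticeQCDFlow` (cell pub-lqcd), topic `Exactness`; FANOUT row 13 (`eng-snf`, GEN-23, replica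
pooling).  NEW WORK of the cell (packaging of `NCMCGeneralSpaceReplicaTStatisticCoverageChains` —
coverage `→ L_R(q)` — with `NCMCGeneralSpaceReplicaTStatisticQuantile` — a `q` with `L_R(q) = 1 − α`
exists); not a published result; no definition is introduced; nothing is cited as a fact (Student's
`t_{R−1}` NAMED ONLY: the `q` below IS its two-sided `1 − α` quantile, unnamed and uncomputed).

WHY (row 13).  The end-to-end statement a user of `latflow-snf`'s replica-jackknife bar needs: for every
miscoverage level `α ∈ (0, 1)` and every `R ≥ 2` there is a number `q = q_R(α) ≥ 0`, defined by the
product standard Gaussian alone (`N(0,1)^{⊗R}{|t| ≤ q} = 1 − α`), such that for EVERY Doeblin-power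
chain, EVERY bounded observable with `σ²_f > 0` and EVERY family of starts, the interval
`ȳ̄_n ± q · √(Σ_r (ȳ_{r,n} − ȳ̄_n)²/(R(R−1)))` covers `πf` with probability `→ 1 − α`.

## Content
* **`exists_calibrated_replicaT_quantile_of_nHit`** — the statement above.

NOT CLAIMED: the value of `q_R(α)`; dependent replicas; unequal lengths; anything numerical.
-/

namespace Summit.Ventures.LatticeQCDFlow.Exactness.GeneralNCMC

open MeasureTheory ProbabilityTheory Filter Finset
open scoped ENNReal NNReal Topology

section Chains

variable {S : Type*} [MeasurableSpace S]
  {κ : Kernel S S} [IsMarkovKernel κ] {π : Measure S} [IsProbabilityMeasure π]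
  {ν : Measure S} [IsProbabilityMeasure ν] {ε : ℝ≥0∞} {m : ℕ}
  {ι : Type*} [Fintype ι] [Nontrivial ι]

/-- **THE CALIBRATED REPLICA-`t` INTERVAL.**  For every `α ∈ (0,1)` there is `q ≥ 0` with
`N(0,1)^{⊗R}{|t| ≤ q} = 1 − α` (a property of `(R, α)` alone) such that, for `R ≥ 2` independent
Doeblin-power chains from ANY starts and any bounded `f` with `σ²_f > 0`,
`P(|((1/R) Σ_r ȳ_{r,n} − πf)/√(Σ_r (ȳ_{r,n} − ȳ̄_n)²/(R(R−1)))| ≤ q) → 1 − α`. -/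
theorem exists_calibrated_replicaT_quantile_of_nHit (hπ : Kernel.Invariant κ π) (hε : ε ≠ 0)
    (hmin : ∀ z, ε • ν ≤ nHit κ m z) (hm : 0 < m)
    {f : S → ℝ} (hf : Measurable f) {C : ℝ} (hC : ∀ x, |f x| ≤ C)
    (hσ : 0 < Scoring.autocov κ π (fun y => f y - ∫ z, f z ∂π) 0
          + 2 * ∑' t, Scoring.autocov κ π (fun y => f y - ∫ z, f z ∂π) (t + 1))
    (μ : ι → Measure S) [∀ r, IsProbabilityMeasure (μ r)]
    [∀ r, IsProbabilityMeasure (Kernel.trajMeasure (X := fun _ : ℕ => S) (μ r)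
        (fun n : ℕ => κ.comap (fun hh : (i : ↥(Finset.Iic n)) → S => hh ⟨n, Finset.mem_Iic.2 le_rfl⟩)
          (measurable_pi_apply _)))]
    {α : ℝ} (hα0 : 0 < α) (hα1 : α < 1) :
    ∃ q : ℝ, 0 ≤ q ∧
      (Measure.pi fun _ : ι => gaussianReal 0 1).real {z : ι → ℝ | |(∑ r, z r) / Fintype.card ι
        / Real.sqrt ((∑ r, (z r - (∑ r', z r') / Fintype.card ι) ^ 2)
            / ((Fintype.card ι : ℝ) * (Fintype.card ι - 1)))| ≤ q} = 1 - α ∧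
      Tendsto (fun n : ℕ => (Measure.pi fun r => Kernel.trajMeasure (X := fun _ : ℕ => S) (μ r)
        (fun n : ℕ => κ.comap (fun hh : (i : ↥(Finset.Iic n)) → S => hh ⟨n, Finset.mem_Iic.2 le_rfl⟩)
          (measurable_pi_apply _)))
        {x : ι → ℕ → S | |((∑ r, (∑ t ∈ range n, f (x r t)) / n) / Fintype.card ι - ∫ z, f z ∂π)
          / Real.sqrt ((∑ r, ((∑ t ∈ range n, f (x r t)) / n
              - (∑ r', (∑ t ∈ range n, f (x r' t)) / n) / Fintype.card ι) ^ 2)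
              / ((Fintype.card ι : ℝ) * (Fintype.card ι - 1)))| ≤ q})
      atTop (𝓝 (ENNReal.ofReal (1 - α))) := by
  obtain ⟨q, hq, hL⟩ := exists_replicaT_calibrating_quantile (ι := ι) hα0 hα1
  refine ⟨q, hq, hL, ?_⟩
  have h := tendsto_measure_abs_replicaTStat_le_of_nHit hπ hε hmin hm hf hC hσ μ hq
  rw [← hL, measureReal_def, ENNReal.ofReal_toReal (measure_ne_top _ _)]
  exact h

end Chains

end Summit.Ventures.LatticeQCDFlow.Exactness.GeneralNCMC
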